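import Mathlib
import Summits.Ventures.HodgeRepro2.T5CornerSimple
import Summits.Ventures.HodgeRepro2.T5CornerSmooth
import Summits.Ventures.HodgeRepro2.T5IsotypicProduct
import Summits.Ventures.HodgeRepro2.T5IsotypicHom

/-!
# The K-level → smooth passage of MVW chap. 2 III.5 in kernel form

Blind cell `pub-hodge-repro2`, seat p8 (gen 6), Tier-5 kernel support for the N3 record
(CHECK-N3 §7 row N3.10.3; the «prose left» item of LEAN-ANNEX-p8 §22: «K-level → smooth passage»).

MVW prove `S[π₁] ≅ π₁ ⊗ V₂′` by passing to the invariants `S[π₁]^K` of small compact open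
subgroups `K`, where `S[π₁]^K` is a semisimple `π₁^K`-isotypic module over `H(G₁, K) = e_K H e_K`
(`T5IsotypicProduct`, p392441 / p392654), and then back to the smooth representation.  This file
records the way back as a statement about a ring `R` (the unitalised Hecke algebra `H(G₁)⁺`), a
simple `R`-module `N` (`π₁`), a module `V` whose `R`-linear maps to `N` separate its points
(`S[π₁] ↪ ∏ π₁`, `quotEmbed_injective`), and idempotents `e` (`e_K`) with `e • N ≠ 0`
(`π₁^K ≠ 0`):

* `Separated R N V` — the maps `V → N` separate points; `separated_isotypicQuot` — `S[N]` is
  separated; `isIsotypicOfType_of_separated` — every simple submodule of a separated module is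
  isomorphic to `N` (Schur);
* `bijective_restrict_spanOf` / `linearEquiv_spanOf` / `isSimpleModule_spanOf` — **the passage
  at one level**: a simple `eRe`-submodule `W` of `e • V` generates an `R`-submodule `R · W ≅ N`
  (proof: `f : V → N` non-zero on `R · W` is onto `N`; its kernel `K` on `R · W` has `e • K = 0`
  because `e • K ⊆ W` and `W` is simple; a non-zero `K` would map onto `N`, forcing `e • N = 0`);
* `isSemisimpleModule_of_isSmoothModule` — **the smooth passage**: if `V` is smooth for a family
  of idempotents `e i`, each `e i • N ≠ 0`, and every corner `e i • V` is semisimple over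
  `e i R e i`, then `V` is a semisimple `R`-module (every vector lies in a finite sum of copies of
  `N`), and `isIsotypicOfType_of_isSmoothModule`: `N`-isotypic;
* `smoothPassageEquiv` — `N ⊗[k] Hom_R(N, V) ≃ₗ[R] V` (MVW III.3 + III.5 at the smooth level)
  under Schur for `N`, via `T5IsotypicHom.evEquiv` (p392230);
* `isotypicQuotSmoothPassageEquiv` — the same for `V = S[N] = S ⧸ S(N)`.

What stays prose: the identification of smooth representations with non-degenerate
`H(G₁)`-modules, `e_K • π = π^K`, and the printed theorems (MVW chap. 2 III.3–III.5; Howe 1989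
Thm 2.1).  Nothing arithmetic is asserted.

README §8(d): uses an L-value-free non-vanishing device: NO.
-/

namespace Summit.Ventures.HodgeRepro2.T5SmoothPassage

open Summit.Ventures.HodgeRepro2.T5CornerSimple
open Summit.Ventures.HodgeRepro2.T5CornerSmooth
open Summit.Ventures.HodgeRepro2.T5IsotypicProduct

section Separated

variable (R : Type*) [Ring R] (N : Type*) [AddCommGroup N] [Module R N]
  (V : Type*) [AddCommGroup V] [Module R V]

/-- The `R`-linear maps `V → N` separate the points of `V` (`V ↪ ∏_{Hom(V,N)} N`). -/
def Separated : Prop := ∀ v : V, v ≠ 0 → ∃ f : V →ₗ[R] N, f v ≠ 0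

variable {R N V}

/-- `S[N] = S ⧸ S(N)` is separated by its maps to `N` (`T5IsotypicProduct.quotEmbed_injective`). -/
theorem separated_isotypicQuot (S : Type*) [AddCommGroup S] [Module R S] :
    Separated R N (S ⧸ isotypicKer R N S) := by
  intro v hv
  have h : quotEmbed R N S v ≠ 0 := by
    intro h0
    exact hv ((quotEmbed_injective R N S) (by rw [h0, map_zero]))
  obtain ⟨f, hf⟩ : ∃ f : S →ₗ[R] N, quotEmbed R N S v f ≠ 0 := by
    by_contra hc
    push Not at hc
    exact h (funext hc)
  exact ⟨(LinearMap.proj f).comp (quotEmbed R N S), hf⟩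

/-- A separated module is `N`-isotypic: every simple submodule maps non-trivially to the simple
module `N`, hence isomorphically (Schur, `LinearMap.bijective_of_ne_zero`). -/
theorem isIsotypicOfType_of_separated [IsSimpleModule R N] (hV : Separated R N V) :
    IsIsotypicOfType R V N := by
  intro m hm
  have : Nontrivial m := IsSimpleModule.nontrivial R m
  obtain ⟨x, hx⟩ := exists_ne (0 : m)
  have hx' : (x : V) ≠ 0 := fun h => hx (Submodule.coe_eq_zero.mp h)
  obtain ⟨f, hf⟩ := hV x hx'
  have hne : f.comp m.subtype ≠ 0 := by
    intro h0
    apply hf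
    have := LinearMap.congr_fun h0 x
    simpa using this
  exact ⟨LinearEquiv.ofBijective _ (LinearMap.bijective_of_ne_zero hne)⟩

/-- A non-zero element of a separated module is detected by some map to `N`; in particular a
separated module with a non-zero element has `N ≠ 0`. -/
theorem exists_map_ne_zero_of_separated (hV : Separated R N V) {v : V} (hv : v ≠ 0) :
    ∃ f : V →ₗ[R] N, f v ≠ 0 := hV v hv

end Separated

section OneLevel

variable {R : Type*} [Ring R] {e : R} (he : IsIdempotentElem e)
  {N : Type*} [AddCommGroup N] [Module R N]
  {V : Type*} [AddCommGroup V] [Module R V]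
  (W : Submodule he.Corner ↥(cornerModule e V))

/-- The image of `W` in `V` lies in `R · W = spanOf he W`. -/
theorem val_mem_spanOf (w : W) : ((w : ↥(cornerModule e V)) : V) ∈ spanOf he W :=
  Submodule.subset_span ⟨w.1, w.2, rfl⟩

/-- `R · W ≠ ⊥` when `W ≠ ⊥`. -/
theorem spanOf_ne_bot [Nontrivial W] : spanOf he W ≠ ⊥ := by
  obtain ⟨w, hw⟩ := exists_ne (0 : W)
  intro hbot
  have hmem := val_mem_spanOf he W w
  rw [hbot, Submodule.mem_bot] at hmem
  exact hw (Subtype.ext (Subtype.ext hmem))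

/-- If an `R`-linear `f : V → N` vanishes on (the image of) `W`, it vanishes on `R · W`. -/
theorem eq_zero_on_spanOf_of_eq_zero_on (f : V →ₗ[R] N)
    (hf : ∀ w : W, f ((w : ↥(cornerModule e V)) : V) = 0) :
    ∀ x ∈ spanOf he W, f x = 0 := by
  have hle : spanOf he W ≤ LinearMap.ker f := by
    refine Submodule.span_le.mpr ?_
    rintro _ ⟨w, hw, rfl⟩
    exact hf ⟨w, hw⟩
  intro x hx
  exact hle hx

/-- The `eRe`-submodule of `W` killed by an `R`-linear `f : V → N`. -/
def kerOn (f : V →ₗ[R] N) : Submodule he.Corner W where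
  carrier := {w | f ((w : ↥(cornerModule e V)) : V) = 0}
  add_mem' := by
    intro a b ha hb
    simp only [Set.mem_setOf_eq] at ha hb ⊢
    change f (((a : ↥(cornerModule e V)) : V) + ((b : ↥(cornerModule e V)) : V)) = 0
    rw [map_add, ha, hb, add_zero]
  zero_mem' := by
    simp only [Set.mem_setOf_eq]
    change f (0 : V) = 0
    exact map_zero f
  smul_mem' := by
    intro c w hw
    simp only [Set.mem_setOf_eq] at hw ⊢
    change f (c.1 • ((w : ↥(cornerModule e V)) : V)) = 0
    rw [map_smul, hw, smul_zero]

/-- Membership in `kerOn`. -/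
theorem mem_kerOn_iff (f : V →ₗ[R] N) (w : W) :
    w ∈ kerOn he W f ↔ f ((w : ↥(cornerModule e V)) : V) = 0 := Iff.rfl

/-- **The corner of the kernel vanishes.** For `W` simple over `eRe` and `f : V → N` non-zero on
`R · W`: every `x ∈ R · W` with `f x = 0` satisfies `e • r • x = 0` for all `r ∈ R`
(because `e • r • x ∈ W` lies in the proper `eRe`-submodule `kerOn`, which is `⊥`). -/
theorem corner_smul_eq_zero_of_map_eq_zero [IsSimpleModule he.Corner W] (f : V →ₗ[R] N)
    (hf : ∃ x ∈ spanOf he W, f x ≠ 0) {x : V} (hx : x ∈ spanOf he W) (hfx : f x = 0) (r : R) :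
    e • r • x = 0 := by
  have hker : kerOn he W f = ⊥ := by
    have hso : IsSimpleOrder (Submodule he.Corner W) :=
      ‹IsSimpleModule he.Corner W›.toIsSimpleOrder
    rcases hso.eq_bot_or_eq_top (kerOn he W f) with h | h
    · exact h
    · exfalso
      obtain ⟨y, hy, hfy⟩ := hf
      apply hfy
      refine eq_zero_on_spanOf_of_eq_zero_on he W f (fun w => ?_) y hy
      have hw : w ∈ kerOn he W f := by rw [h]; trivial
      exact (mem_kerOn_iff he W f w).mp hw
  obtain ⟨w, hwW, hw⟩ := smul_mem_of_mem_spanOf he W hx r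
  have hfw : f ((w : ↥(cornerModule e V)) : V) = 0 := by
    rw [hw, map_smul, map_smul, hfx, smul_zero, smul_zero]
  have hmem : (⟨w, hwW⟩ : W) ∈ kerOn he W f := (mem_kerOn_iff he W f _).mpr hfw
  rw [hker, Submodule.mem_bot] at hmem
  have h0 : ((w : ↥(cornerModule e V)) : V) = 0 := by
    have := congrArg (fun z : W => ((z : ↥(cornerModule e V)) : V)) hmem
    simpa using this
  rw [← hw, h0]

/-- **Injectivity on `R · W`.** For `N` simple, `V` separated, `e • N ≠ 0`, `W` simple over `eRe`
and `f : V → N` non-zero on `R · W`: `f` is injective on `R · W`. -/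
theorem eq_zero_of_map_eq_zero [IsSimpleModule R N] [IsSimpleModule he.Corner W]
    (hV : Separated R N V) (hN : ∃ n : N, e • n ≠ 0) (f : V →ₗ[R] N)
    (hf : ∃ x ∈ spanOf he W, f x ≠ 0) {x : V} (hx : x ∈ spanOf he W) (hfx : f x = 0) : x = 0 := by
  by_contra hx0
  -- the kernel of `f` on `R · W`, an `R`-submodule with `e • K = 0`
  let K : Submodule R V := spanOf he W ⊓ LinearMap.ker f
  have hxK : x ∈ K := ⟨hx, hfx⟩
  have hK : ∀ y ∈ K, e • y = 0 := by
    intro y hy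
    have := corner_smul_eq_zero_of_map_eq_zero he W f hf hy.1 hy.2 1
    rwa [one_smul] at this
  -- a non-zero `K` maps onto `N`
  obtain ⟨g, hg⟩ := hV x hx0
  have hne : g.comp K.subtype ≠ 0 := by
    intro h0
    apply hg
    have := LinearMap.congr_fun h0 ⟨x, hxK⟩
    simpa using this
  have hsurj := LinearMap.surjective_of_ne_zero hne
  obtain ⟨n, hn⟩ := hN
  obtain ⟨y, hy⟩ := hsurj n
  apply hn
  rw [← hy]
  have : e • (g.comp K.subtype) y = g (e • (y : V)) := by
    simp [map_smul]
  rw [this, hK y y.2, map_zero]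

/-- **The passage at one level.** `f : V → N` non-zero on `R · W` restricts to a bijection
`R · W ≃ N` (injective by `eq_zero_of_map_eq_zero`, onto since `N` is simple). -/
theorem bijective_restrict_spanOf [IsSimpleModule R N] [IsSimpleModule he.Corner W]
    (hV : Separated R N V) (hN : ∃ n : N, e • n ≠ 0) (f : V →ₗ[R] N)
    (hf : ∃ x ∈ spanOf he W, f x ≠ 0) :
    Function.Bijective (f.comp (spanOf he W).subtype) := by
  constructor
  · rw [← LinearMap.ker_eq_bot, eq_bot_iff]
    intro y hy
    rw [LinearMap.mem_ker] at hy
    have : (y : V) = 0 :=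
      eq_zero_of_map_eq_zero he W hV hN f hf y.2 (by simpa using hy)
    exact Submodule.coe_eq_zero.mp this
  · apply LinearMap.surjective_of_ne_zero
    intro h0
    obtain ⟨x, hx, hfx⟩ := hf
    apply hfx
    have := LinearMap.congr_fun h0 ⟨x, hx⟩
    simpa using this

/-- **A simple `eRe`-submodule of `e • V` generates a copy of `N`**: `R · W ≃ₗ[R] N`. -/
theorem linearEquiv_spanOf [IsSimpleModule R N] [IsSimpleModule he.Corner W]
    (hV : Separated R N V) (hN : ∃ n : N, e • n ≠ 0) :
    Nonempty (spanOf he W ≃ₗ[R] N) := by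
  have : Nontrivial W := IsSimpleModule.nontrivial he.Corner W
  obtain ⟨x, hx, hx0⟩ : ∃ x ∈ spanOf he W, x ≠ 0 := by
    by_contra hc
    push Not at hc
    exact spanOf_ne_bot he W ((Submodule.eq_bot_iff _).mpr hc)
  obtain ⟨f, hf⟩ := hV x hx0
  exact ⟨LinearEquiv.ofBijective _ (bijective_restrict_spanOf he W hV hN f ⟨x, hx, hf⟩)⟩

/-- `R · W` is a simple `R`-module. -/
theorem isSimpleModule_spanOf [IsSimpleModule R N] [IsSimpleModule he.Corner W]
    (hV : Separated R N V) (hN : ∃ n : N, e • n ≠ 0) :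
    IsSimpleModule R (spanOf he W) := by
  obtain ⟨φ⟩ := linearEquiv_spanOf he W hV hN
  exact IsSimpleModule.congr φ

/-- Every vector of `e • V` lying in a simple `eRe`-submodule lies in a simple `R`-submodule
of `V` (namely `R · W`). -/
theorem mem_sSup_simples_of_mem [IsSimpleModule R N] [IsSimpleModule he.Corner W]
    (hV : Separated R N V) (hN : ∃ n : N, e • n ≠ 0) (w : W) :
    ((w : ↥(cornerModule e V)) : V) ∈ sSup {m : Submodule R V | IsSimpleModule R m} :=
  Submodule.mem_sSup_of_mem
    (show spanOf he W ∈ {m : Submodule R V | IsSimpleModule R m} from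
      isSimpleModule_spanOf he W hV hN)
    (val_mem_spanOf he W w)

end OneLevel

section Smooth

variable {R : Type*} [Ring R] {ι : Type*} (e : ι → R) (he : ∀ i, IsIdempotentElem (e i))
  {N : Type*} [AddCommGroup N] [Module R N]
  {V : Type*} [AddCommGroup V] [Module R V]

/-- **The smooth passage.** Let `V` be smooth for the idempotents `e i` (every vector is fixed by
some `e i`), let the maps `V → N` separate points (`N` simple), `e i • N ≠ 0` for every `i`, and
let every corner `e i • V` be a semisimple module over the corner ring `e i R e i`.  Then `V` is
a semisimple `R`-module: every vector lies in a finite sum of submodules isomorphic to `N`. -/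
theorem isSemisimpleModule_of_isSmoothModule [IsSimpleModule R N] (hV : Separated R N V)
    (hs : IsSmoothModule e (M := V)) (hN : ∀ i, ∃ n : N, e i • n ≠ 0)
    (hss : ∀ i, IsSemisimpleModule (he i).Corner ↥(cornerModule (e i) V)) :
    IsSemisimpleModule R V := by
  apply IsSemisimpleModule.of_sSup_simples_eq_top
  rw [eq_top_iff]
  intro v _
  obtain ⟨i, hi⟩ := hs v
  have hv : v ∈ cornerModule (e i) V := (mem_cornerModule_iff (he i)).mpr hi
  haveI := hss i
  have htop := IsSemisimpleModule.sSup_simples_eq_top (he i).Corner ↥(cornerModule (e i) V)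
  have hx := htop.ge (Submodule.mem_top : (⟨v, hv⟩ : ↥(cornerModule (e i) V)) ∈ ⊤)
  rw [sSup_eq_iSup'] at hx
  refine Submodule.iSup_induction (motive := fun x : ↥(cornerModule (e i) V) =>
    (x : V) ∈ sSup {m : Submodule R V | IsSimpleModule R m}) _ hx ?_ ?_ ?_
  · rintro ⟨m, hm⟩ x hxm
    haveI : IsSimpleModule (he i).Corner m := hm
    exact mem_sSup_simples_of_mem (he i) m hV (hN i) ⟨x, hxm⟩
  · exact Submodule.zero_mem _
  · intro x y hx hy
    exact Submodule.add_mem _ hx hy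

/-- The smooth passage, isotypic half: a separated module is `N`-isotypic (no smoothness needed). -/
theorem isIsotypicOfType_of_isSmoothModule [IsSimpleModule R N] (hV : Separated R N V) :
    IsIsotypicOfType R V N :=
  isIsotypicOfType_of_separated hV

end Smooth

section Equiv

variable {k R : Type*} [Field k] [Ring R] [Algebra k R] {ι : Type*} (e : ι → R)
  (he : ∀ i, IsIdempotentElem (e i))
  {N : Type*} [AddCommGroup N] [Module R N] [Module k N] [IsScalarTower k R N]
  {V : Type*} [AddCommGroup V] [Module R V] [Module k V] [IsScalarTower k R V]

/-- **MVW III.3 + III.5 at the smooth level.** Under the hypotheses of the smooth passage and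
Schur for `N` (`End_R(N) = k`), `N ⊗[k] Hom_R(N, V) ≃ₗ[R] V`, `n ⊗ f ↦ f n`
(`T5IsotypicHom.evEquiv`). -/
noncomputable def smoothPassageEquiv [IsSimpleModule R N]
    (hSchur : ∀ φ : N →ₗ[R] N, ∃ c : k, ∀ x, φ x = c • x)
    (hV : Separated R N V) (hs : IsSmoothModule e (M := V)) (hN : ∀ i, ∃ n : N, e i • n ≠ 0)
    (hss : ∀ i, IsSemisimpleModule (he i).Corner ↥(cornerModule (e i) V)) :
    TensorProduct k N (N →ₗ[R] V) ≃ₗ[R] V :=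
  haveI : Nontrivial N := IsSimpleModule.nontrivial R N
  haveI : IsSemisimpleModule R V := isSemisimpleModule_of_isSmoothModule e he hV hs hN hss
  T5IsotypicHom.evEquiv hSchur (isIsotypicOfType_of_separated hV)

/-- `smoothPassageEquiv (n ⊗ f) = f n`. -/
theorem smoothPassageEquiv_tmul [IsSimpleModule R N]
    (hSchur : ∀ φ : N →ₗ[R] N, ∃ c : k, ∀ x, φ x = c • x)
    (hV : Separated R N V) (hs : IsSmoothModule e (M := V)) (hN : ∀ i, ∃ n : N, e i • n ≠ 0)
    (hss : ∀ i, IsSemisimpleModule (he i).Corner ↥(cornerModule (e i) V))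
    (n : N) (f : N →ₗ[R] V) :
    smoothPassageEquiv e he hSchur hV hs hN hss (n ⊗ₜ[k] f) = f n := by
  haveI : Nontrivial N := IsSimpleModule.nontrivial R N
  haveI : IsSemisimpleModule R V := isSemisimpleModule_of_isSmoothModule e he hV hs hN hss
  exact T5IsotypicHom.evEquiv_tmul hSchur (isIsotypicOfType_of_separated hV) n f

/-- **`S[N] ≅ N ⊗ Hom(N, S[N])` at the smooth level**: for `V = S[N] = S ⧸ S(N)` the separation
hypothesis is automatic (`separated_isotypicQuot`). -/
noncomputable def isotypicQuotSmoothPassageEquiv [IsSimpleModule R N]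
    (hSchur : ∀ φ : N →ₗ[R] N, ∃ c : k, ∀ x, φ x = c • x)
    (S : Type*) [AddCommGroup S] [Module R S] [Module k S] [IsScalarTower k R S]
    (hs : IsSmoothModule e (M := S ⧸ isotypicKer R N S)) (hN : ∀ i, ∃ n : N, e i • n ≠ 0)
    (hss : ∀ i, IsSemisimpleModule (he i).Corner ↥(cornerModule (e i) (S ⧸ isotypicKer R N S))) :
    TensorProduct k N (N →ₗ[R] S ⧸ isotypicKer R N S) ≃ₗ[R] S ⧸ isotypicKer R N S :=
  smoothPassageEquiv e he hSchur (separated_isotypicQuot S) hs hN hss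

end Equiv

end Summit.Ventures.HodgeRepro2.T5SmoothPassage
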